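import Mathlib
import Literature.RepresentationTheory.FiniteGroups.GLnClassNumber
import Summits.MatrixMultiplication.MatrixMultiplication.Theorems.SubgroupIdentityDesigns.Negative.TensorRankBridge

/-!
# Level and field-degree laws for `SubgroupIdentityDesigns`, with the class-number inputs
# discharged by the vendored Fulman–Guralnick fact
# (support file for stmt-MatrixMultiplication-14079; cell B2b-5 `b2b-lgcu-borel`, gen 12 —
# report `run/shared/lean/b2b/levelgraded-cu/ORACLE-g12.md` §G12-3)

`TensorRankBridge.linear_level_law` / `field_degree_law` carried the class-number bounds
`#Cl(GL_j(𝔽_p)) ≤ p^j` as hypotheses.  The Literature now holds them as the named fact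
`FulmanGuralnick2012_prop35` (`GLnClassNumber.lean`, Maslen–Rockmore / Fulman–Guralnick 2012
Prop. 3.5(2)).  This file plugs it in and extracts explicit, decidable thresholds.  A *witness of the
crux at `ε`* below means: a prime `p`, `m`, `k`, a subgroup-TPP triple `H₁, H₂, H₃ ≤ GL_m(𝔽_p)` with
a level-`k` identity design, beating the level-`k` budget at exponent `2 + ε` — i.e. exactly one
instance of the existential in `SubgroupIdentityDesigns ε`.

* `linear_level_law` — (GH count + FG class numbers) every witness with `1 ≤ k`, `2k ≤ m` has
  `(2 − 2ε)/3 · log 2 < k ε log p`;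
* `field_degree_law` — (FG only) every witness has `(2 + ε)/3 · log 2 < m ε log p`;
* `level_law_all` — (GH + FG) every witness with `1 ≤ k` (no restriction on `m`) has
  `min((2 − 2ε)/3, (2 + ε)/6) · log 2 < k ε log p`;
* thresholds: `no_witness_of_eps_mul_le_level` (`ε (3k log p + 2 log 2) ≤ 2 log 2` ⇒ no witness,
  `2k ≤ m`), `no_witness_of_eps_mul_le_field` (`ε (3m log p − log 2) ≤ 2 log 2` ⇒ no witness);
* at `ε ≤ 1/100`: `66 log 2 < k log p` (`2k ≤ m`), `67 log 2 < m log p` (always), hence over `𝔽_2`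
  every witness has `m ≥ 68`, and `k ≥ 67, m ≥ 134` if `2k ≤ m` (`F2_thresholds_eps_le_hundredth`).

VALUE = theorem (explicit no-go thresholds for the crux's witnesses, conditional only on two vendored
Literature facts), NOT summit progress; the crux item stays open.
-/

set_option linter.dupNamespace false

noncomputable section

open scoped BigOperators Matrix
open Literature.RepresentationTheory.FiniteGroups Literature.Barriers.MatrixMultiplication

namespace Summit.MatrixMultiplication.MatrixMultiplication.Theorems.SubgroupIdentityDesigns.Negative
namespace ClassNumberLaws

open Summit.MatrixMultiplication.MatrixMultiplication.Theorems.LieRankDesigns.Negative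
  (GLm Mat levelSet budget fourierFn RankSupp)

variable {p : ℕ} [hp : Fact p.Prime] {m : ℕ}

/-- `#Cl(GL_j(𝔽_p)) ≤ p^j` for every `j`, from the Fulman–Guralnick fact.
[cite: FulmanGuralnick2012, Prop. 3.5(2)] -/
theorem classNumber_GL_ZMod_le (hFG : FulmanGuralnick2012_prop35) (j : ℕ) :
    Nat.card (ConjClasses (Matrix.GeneralLinearGroup (Fin j) (ZMod p))) ≤ p ^ j := by
  have h := hFG.classNumber_GL_le (ZMod p) j
  rwa [ZMod.card] at h

/-- **LINEAR LEVEL LAW** (Gurevich–Howe count + Fulman–Guralnick class numbers): every witness of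
the crux at `ε` with `1 ≤ k`, `2k ≤ m` has `(2 − 2ε)/3 · log 2 < k · ε · log p`. -/
theorem linear_level_law (hGH : GurevichHowe2021_etaCorrespondence_card)
    (hFG : FulmanGuralnick2012_prop35) {k : ℕ} (hk : 1 ≤ k) (h2k : 2 * k ≤ m)
    {ε : ℝ} (hε : 0 < ε)
    {H₁ H₂ H₃ : Subgroup (GLm p m)} (htpp : SubgroupTPP H₁ H₂ H₃)
    (hdes : ∃ c : Mat p m → ℂ, (∀ M, k < M.rank → c M = 0) ∧
      (∑ M, c M * ZMod.stdAddChar (Matrix.trace (M * ((1 : GLm p m) : Mat p m)))) = 1 ∧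
      ∀ a ∈ H₁, ∀ b ∈ H₂, ∀ g ∈ H₃, a * b * g ≠ 1 →
        (∑ M, c M * ZMod.stdAddChar
          (Matrix.trace (M * ((a * b * g : GLm p m) : Mat p m)))) = 0)
    (hlt : budget p m k (2 + ε) <
      ((Nat.card H₁ * Nat.card H₂ * Nat.card H₃ : ℕ) : ℝ) ^ ((2 + ε) / 3)) :
    (2 - 2 * ε) / 3 * Real.log 2 < k * ε * Real.log p :=
  TensorRankBridge.linear_level_law hGH hk h2k (fun j _ => classNumber_GL_ZMod_le hFG j)
    hε htpp hdes hlt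

/-- **FIELD–DEGREE LAW** (Fulman–Guralnick class numbers only): every witness of the crux at `ε`
(any level `k`) has `(2 + ε)/3 · log 2 < m · ε · log p`. -/
theorem field_degree_law (hFG : FulmanGuralnick2012_prop35) {k : ℕ} {ε : ℝ} (hε : 0 < ε)
    {H₁ H₂ H₃ : Subgroup (GLm p m)} (htpp : SubgroupTPP H₁ H₂ H₃)
    (hdes : ∃ c : Mat p m → ℂ, (∀ M, k < M.rank → c M = 0) ∧
      (∑ M, c M * ZMod.stdAddChar (Matrix.trace (M * ((1 : GLm p m) : Mat p m)))) = 1 ∧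
      ∀ a ∈ H₁, ∀ b ∈ H₂, ∀ g ∈ H₃, a * b * g ≠ 1 →
        (∑ M, c M * ZMod.stdAddChar
          (Matrix.trace (M * ((a * b * g : GLm p m) : Mat p m)))) = 0)
    (hlt : budget p m k (2 + ε) <
      ((Nat.card H₁ * Nat.card H₂ * Nat.card H₃ : ℕ) : ℝ) ^ ((2 + ε) / 3)) :
    (2 + ε) / 3 * Real.log 2 < m * ε * Real.log p :=
  TensorRankBridge.field_degree_law (classNumber_GL_ZMod_le hFG m) hε htpp hdes hlt

/-- **LEVEL LAW FOR EVERY LEVEL** `k ≥ 1` (no restriction `2k ≤ m`): every witness has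
`min((2 − 2ε)/3, (2 + ε)/6) · log 2 < k · ε · log p` (the first branch when `2k ≤ m`, the second —
via the field-degree law and `m < 2k` — otherwise). -/
theorem level_law_all (hGH : GurevichHowe2021_etaCorrespondence_card)
    (hFG : FulmanGuralnick2012_prop35) {k : ℕ} (hk : 1 ≤ k) {ε : ℝ} (hε : 0 < ε)
    {H₁ H₂ H₃ : Subgroup (GLm p m)} (htpp : SubgroupTPP H₁ H₂ H₃)
    (hdes : ∃ c : Mat p m → ℂ, (∀ M, k < M.rank → c M = 0) ∧
      (∑ M, c M * ZMod.stdAddChar (Matrix.trace (M * ((1 : GLm p m) : Mat p m)))) = 1 ∧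
      ∀ a ∈ H₁, ∀ b ∈ H₂, ∀ g ∈ H₃, a * b * g ≠ 1 →
        (∑ M, c M * ZMod.stdAddChar
          (Matrix.trace (M * ((a * b * g : GLm p m) : Mat p m)))) = 0)
    (hlt : budget p m k (2 + ε) <
      ((Nat.card H₁ * Nat.card H₂ * Nat.card H₃ : ℕ) : ℝ) ^ ((2 + ε) / 3)) :
    min ((2 - 2 * ε) / 3) ((2 + ε) / 6) * Real.log 2 < k * ε * Real.log p := by
  have hlog2 : 0 < Real.log 2 := Real.log_pos (by norm_num)
  have hlogp : 0 ≤ Real.log p := Real.log_nonneg (by exact_mod_cast hp.out.one_lt.le)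
  rcases le_or_gt (2 * k) m with h2k | hm2k
  · have h := linear_level_law hGH hFG hk h2k hε htpp hdes hlt
    calc min ((2 - 2 * ε) / 3) ((2 + ε) / 6) * Real.log 2
        ≤ (2 - 2 * ε) / 3 * Real.log 2 :=
          mul_le_mul_of_nonneg_right (min_le_left _ _) hlog2.le
      _ < k * ε * Real.log p := h
  · have h := field_degree_law hFG hε htpp hdes hlt
    have hmk : (m : ℝ) ≤ 2 * k := by exact_mod_cast hm2k.le
    have hmono : (m : ℝ) * ε * Real.log p ≤ 2 * k * ε * Real.log p := by
      have := mul_le_mul_of_nonneg_right (mul_le_mul_of_nonneg_right hmk hε.le) hlogp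
      linarith
    calc min ((2 - 2 * ε) / 3) ((2 + ε) / 6) * Real.log 2
        ≤ (2 + ε) / 6 * Real.log 2 :=
          mul_le_mul_of_nonneg_right (min_le_right _ _) hlog2.le
      _ < k * ε * Real.log p := by linarith

/-! ## Explicit thresholds -/

/-- **Level threshold.**  If `ε · (3k log p + 2 log 2) ≤ 2 log 2` (i.e.
`ε ≤ 2 log 2 / (3 k log p + 2 log 2)`), there is NO witness at `ε` with `1 ≤ k`, `2k ≤ m`:
the budget inequality fails for every subgroup-TPP triple carrying a level-`k` identity design.
(Example: `p = 2`, `k = 2`, `m ≥ 4`: dead for all `ε ≤ 1/4`.) -/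
theorem no_witness_of_eps_mul_le_level (hGH : GurevichHowe2021_etaCorrespondence_card)
    (hFG : FulmanGuralnick2012_prop35) {k : ℕ} (hk : 1 ≤ k) (h2k : 2 * k ≤ m)
    {ε : ℝ} (hε : 0 < ε) (hεle : ε * (3 * k * Real.log p + 2 * Real.log 2) ≤ 2 * Real.log 2)
    {H₁ H₂ H₃ : Subgroup (GLm p m)} (htpp : SubgroupTPP H₁ H₂ H₃)
    (hdes : ∃ c : Mat p m → ℂ, (∀ M, k < M.rank → c M = 0) ∧
      (∑ M, c M * ZMod.stdAddChar (Matrix.trace (M * ((1 : GLm p m) : Mat p m)))) = 1 ∧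
      ∀ a ∈ H₁, ∀ b ∈ H₂, ∀ g ∈ H₃, a * b * g ≠ 1 →
        (∑ M, c M * ZMod.stdAddChar
          (Matrix.trace (M * ((a * b * g : GLm p m) : Mat p m)))) = 0) :
    ¬ budget p m k (2 + ε) <
      ((Nat.card H₁ * Nat.card H₂ * Nat.card H₃ : ℕ) : ℝ) ^ ((2 + ε) / 3) := by
  intro hlt
  have h := linear_level_law hGH hFG hk h2k hε htpp hdes hlt
  nlinarith [h, hεle]

/-- **Field threshold.**  If `ε · (3m log p − log 2) ≤ 2 log 2` (i.e. `p^{3mε} ≤ 2^{2+ε}`), there is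
NO witness at `ε` in `GL_m(𝔽_p)` at any level. -/
theorem no_witness_of_eps_mul_le_field (hFG : FulmanGuralnick2012_prop35) {k : ℕ}
    {ε : ℝ} (hε : 0 < ε) (hεle : ε * (3 * m * Real.log p - Real.log 2) ≤ 2 * Real.log 2)
    {H₁ H₂ H₃ : Subgroup (GLm p m)} (htpp : SubgroupTPP H₁ H₂ H₃)
    (hdes : ∃ c : Mat p m → ℂ, (∀ M, k < M.rank → c M = 0) ∧
      (∑ M, c M * ZMod.stdAddChar (Matrix.trace (M * ((1 : GLm p m) : Mat p m)))) = 1 ∧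
      ∀ a ∈ H₁, ∀ b ∈ H₂, ∀ g ∈ H₃, a * b * g ≠ 1 →
        (∑ M, c M * ZMod.stdAddChar
          (Matrix.trace (M * ((a * b * g : GLm p m) : Mat p m)))) = 0) :
    ¬ budget p m k (2 + ε) <
      ((Nat.card H₁ * Nat.card H₂ * Nat.card H₃ : ℕ) : ℝ) ^ ((2 + ε) / 3) := by
  intro hlt
  have h := field_degree_law hFG hε htpp hdes hlt
  nlinarith [h, hεle]

/-- **At `ε ≤ 1/100`, level side:** every witness with `1 ≤ k`, `2k ≤ m` has `66 · log 2 < k · log p`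
(so `k · log₂ p > 66`; over `𝔽_2`, `k ≥ 67`). -/
theorem level_bound_eps_le_hundredth (hGH : GurevichHowe2021_etaCorrespondence_card)
    (hFG : FulmanGuralnick2012_prop35) {k : ℕ} (hk : 1 ≤ k) (h2k : 2 * k ≤ m)
    {ε : ℝ} (hε : 0 < ε) (hε1 : ε ≤ 1 / 100)
    {H₁ H₂ H₃ : Subgroup (GLm p m)} (htpp : SubgroupTPP H₁ H₂ H₃)
    (hdes : ∃ c : Mat p m → ℂ, (∀ M, k < M.rank → c M = 0) ∧
      (∑ M, c M * ZMod.stdAddChar (Matrix.trace (M * ((1 : GLm p m) : Mat p m)))) = 1 ∧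
      ∀ a ∈ H₁, ∀ b ∈ H₂, ∀ g ∈ H₃, a * b * g ≠ 1 →
        (∑ M, c M * ZMod.stdAddChar
          (Matrix.trace (M * ((a * b * g : GLm p m) : Mat p m)))) = 0)
    (hlt : budget p m k (2 + ε) <
      ((Nat.card H₁ * Nat.card H₂ * Nat.card H₃ : ℕ) : ℝ) ^ ((2 + ε) / 3)) :
    66 * Real.log 2 < k * Real.log p := by
  have h := linear_level_law hGH hFG hk h2k hε htpp hdes hlt
  have hlog2 : 0 < Real.log 2 := Real.log_pos (by norm_num)
  by_contra hcon
  push Not at hcon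
  have h1 : (k : ℝ) * ε * Real.log p ≤ 66 * Real.log 2 * ε := by
    have := mul_le_mul_of_nonneg_right hcon hε.le
    linarith
  nlinarith [h, h1, hε1, hlog2]

/-- **At `ε ≤ 1/100`, field side:** every witness has `67 · log 2 < m · log p`
(so `m · log₂ p > 67`; over `𝔽_2`, `m ≥ 68`). -/
theorem field_bound_eps_le_hundredth (hFG : FulmanGuralnick2012_prop35) {k : ℕ}
    {ε : ℝ} (hε : 0 < ε) (hε1 : ε ≤ 1 / 100)
    {H₁ H₂ H₃ : Subgroup (GLm p m)} (htpp : SubgroupTPP H₁ H₂ H₃)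
    (hdes : ∃ c : Mat p m → ℂ, (∀ M, k < M.rank → c M = 0) ∧
      (∑ M, c M * ZMod.stdAddChar (Matrix.trace (M * ((1 : GLm p m) : Mat p m)))) = 1 ∧
      ∀ a ∈ H₁, ∀ b ∈ H₂, ∀ g ∈ H₃, a * b * g ≠ 1 →
        (∑ M, c M * ZMod.stdAddChar
          (Matrix.trace (M * ((a * b * g : GLm p m) : Mat p m)))) = 0)
    (hlt : budget p m k (2 + ε) <
      ((Nat.card H₁ * Nat.card H₂ * Nat.card H₃ : ℕ) : ℝ) ^ ((2 + ε) / 3)) :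
    67 * Real.log 2 < m * Real.log p := by
  have h := field_degree_law hFG hε htpp hdes hlt
  have hlog2 : 0 < Real.log 2 := Real.log_pos (by norm_num)
  by_contra hcon
  push Not at hcon
  have h1 : (m : ℝ) * ε * Real.log p ≤ 67 * Real.log 2 * ε := by
    have := mul_le_mul_of_nonneg_right hcon hε.le
    linarith
  nlinarith [h, h1, hε1, hlog2]

/-- **Over `𝔽_2` at `ε ≤ 1/100`** (decidable thresholds): every witness in `GL_m(𝔽_2)` has `68 ≤ m`,
and if moreover `1 ≤ k`, `2k ≤ m` then `67 ≤ k` (hence `134 ≤ m`). -/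
theorem F2_thresholds_eps_le_hundredth [Fact (Nat.Prime 2)]
    (hGH : GurevichHowe2021_etaCorrespondence_card) (hFG : FulmanGuralnick2012_prop35)
    {m k : ℕ} {ε : ℝ} (hε : 0 < ε) (hε1 : ε ≤ 1 / 100)
    {H₁ H₂ H₃ : Subgroup (GLm 2 m)} (htpp : SubgroupTPP H₁ H₂ H₃)
    (hdes : ∃ c : Mat 2 m → ℂ, (∀ M, k < M.rank → c M = 0) ∧
      (∑ M, c M * ZMod.stdAddChar (Matrix.trace (M * ((1 : GLm 2 m) : Mat 2 m)))) = 1 ∧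
      ∀ a ∈ H₁, ∀ b ∈ H₂, ∀ g ∈ H₃, a * b * g ≠ 1 →
        (∑ M, c M * ZMod.stdAddChar
          (Matrix.trace (M * ((a * b * g : GLm 2 m) : Mat 2 m)))) = 0)
    (hlt : budget 2 m k (2 + ε) <
      ((Nat.card H₁ * Nat.card H₂ * Nat.card H₃ : ℕ) : ℝ) ^ ((2 + ε) / 3)) :
    68 ≤ m ∧ (1 ≤ k → 2 * k ≤ m → 67 ≤ k ∧ 134 ≤ m) := by
  have hlog2 : 0 < Real.log 2 := Real.log_pos (by norm_num)
  have hf := field_bound_eps_le_hundredth (p := 2) hFG hε hε1 htpp hdes hlt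
  have hm : (67 : ℝ) < m := by
    have : (67 : ℝ) * Real.log 2 < m * Real.log 2 := by exact_mod_cast hf
    exact lt_of_mul_lt_mul_right this hlog2.le
  have hm' : 68 ≤ m := by exact_mod_cast hm
  refine ⟨hm', fun hk h2k => ?_⟩
  have hl := level_bound_eps_le_hundredth (p := 2) hGH hFG hk h2k hε hε1 htpp hdes hlt
  have hkR : (66 : ℝ) < k := by
    have : (66 : ℝ) * Real.log 2 < k * Real.log 2 := by exact_mod_cast hl
    exact lt_of_mul_lt_mul_right this hlog2.le
  have hk' : 67 ≤ k := by exact_mod_cast hkR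
  exact ⟨hk', by omega⟩

end ClassNumberLaws
end Summit.MatrixMultiplication.MatrixMultiplication.Theorems.SubgroupIdentityDesigns.Negative
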